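import Literature.NumberTheory.GaloisCohomology.KatoCohomologyDifferentialForms
import Mathlib.LinearAlgebra.ExteriorPower.Basic
import Mathlib.RingTheory.Kaehler.Basic
import Mathlib.RingTheory.Derivation.Basic
import Literature.NumberTheory.GaloisCohomology.BlochKatoFormsSymbol
import HarnessLib

/-!
# Bloch–Kato 1986, Lemma (4.2): the symbolic presentation of Kato's `H^{n+1}_p(K)` for a field `K` of
# characteristic `p` — Literature-side DISCHARGE of `BlochKato1986_symbolicPresentation`

RE-HOMED into Literature (seat bsd-rank2-lit GEN 14, 2026-08-27; HIDDEN-DISCHARGES sweep,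
run/shared/lean/pub/bsd-rank2/lit/HIDDEN-DISCHARGES.md): verbatim concatenation of the five Summits files
`Summits/ResolutionOfSingularities/ResolutionOfSingularities/Theorems/WildPurityPurityTransfer{StubFormsSpan,StubBkForward,StubBkDescends,StubBkAssemble,BlochKatoPresentation}.lean`
(cell ResolutionOfSingularities, crux `WildPurity.PurityTransfer` stmt-ResolutionOfSingularities-17142, line `birth`, lead c1 —
the authors of the mathematics), which import only Literature/Mathlib; namespace
`Summit.ResolutionOfSingularities.ResolutionOfSingularities.Theorems.WildPurityPurityTransfer` ↦
`Literature.NumberTheory.GaloisCohomology.BlochKato1986Presentation`, route-stub names `stub_formsSpan` / `stub_bkForward` /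
`stub_bkDescends` / `stub_bkAssemble` ↦ `bk_formsSpan` / `bk_forward` / `bk_descends` / `bk_assemble`; the discharge
`Literature.NumberTheory.GaloisCohomology.BlochKato1986_symbolicPresentation_holds` is declared next to the fact
(`KatoCohomologyDifferentialForms.lean`). Theorems only, no definitions; cite tags added per decl. The original module
headers follow as section comments.
-/


noncomputable section

universe u

/-!
# Stub `bk_formsSpan` of crux stmt-ResolutionOfSingularities-17142
# (`WildPurity.PurityTransfer`, line `birth`, lead c1 skeleton rev L4)

The SURJECTIVITY half of Bloch–Kato's Lemma (4.2) for a field `K`: the logarithmic `n`-forms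
`dlog b₀ ∧ ⋯ ∧ dlog b_{n-1}` (`dlogForm K b`, `b : Fin n → Kˣ`) span `Ωⁿ_K = ⋀ⁿ_K Ω[K⁄ℤ]` over `K`.

Proof: `Ω[K⁄ℤ]` is spanned over `K` by the `da` (`KaehlerDifferential.span_range_derivation`), hence
`⋀ⁿ_K Ω[K⁄ℤ]` by the `da₀ ∧ ⋯ ∧ da_{n-1}` (`exteriorPower.ιMulti_span_of_span`); such a product is
`0` if some `aᵢ = 0`, and otherwise equals `(∏ aᵢ) • dlogForm K a` since `da = a • dlog a` for a
unit `a` (multilinearity, `AlternatingMap.map_smul_univ`).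
-/




open Literature.NumberTheory.GaloisCohomology
open KaehlerDifferential (D)

namespace Literature.NumberTheory.GaloisCohomology.BlochKato1986Presentation

/-- For a unit `b` of a commutative ring, `db = b • dlog b`. [folklore]
[cite: BlochKato1986, Lemma (4.2), p. 122] -/
theorem formsSpan_D_eq_smul_unitDlog (K : Type u) [CommRing K] (b : Kˣ) :
    D ℤ K (b : K) = (b : K) • unitDlog K b := by
  unfold unitDlog
  rw [smul_smul, Units.mul_inv, one_smul]

/-- For a tuple of units `b`, `db₀ ∧ ⋯ ∧ db_{n-1} = (∏ bᵢ) • (dlog b₀ ∧ ⋯ ∧ dlog b_{n-1})`.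
[folklore]
[cite: BlochKato1986, Lemma (4.2), p. 122] -/
theorem formsSpan_ιMulti_D_eq_prod_smul_dlogForm (K : Type u) [CommRing K] {n : ℕ}
    (b : Fin n → Kˣ) :
    exteriorPower.ιMulti K n (fun i => D ℤ K (b i : K)) = (∏ i, (b i : K)) • dlogForm K b := by
  unfold dlogForm
  rw [← AlternatingMap.map_smul_univ]
  congr 1
  ext i
  exact formsSpan_D_eq_smul_unitDlog K (b i)

/-- **Bloch–Kato, Lemma (4.2), surjectivity of `δ`, for a field**: the logarithmic forms
`dlog b₀ ∧ ⋯ ∧ dlog b_{n-1}` span `Ωⁿ_K = ⋀ⁿ_K Ω[K⁄ℤ]` over `K`.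
[cite: BlochKato1986, Lemma (4.2)] -/
theorem bk_formsSpan (K : Type u) [Field K] (n : ℕ) :
    Submodule.span K (Set.range (dlogForm K (n := n))) = ⊤ := by
  rw [eq_top_iff, ← exteriorPower.ιMulti_span_of_span K n (Ω[K⁄ℤ])
    (KaehlerDifferential.span_range_derivation (R := ℤ) (S := K)), Submodule.span_le]
  rintro _ ⟨a, ha, rfl⟩
  -- `a : Fin n → Ω[K⁄ℤ]` with every `a i` of the form `D x`
  choose x hx using fun i => ha (Set.mem_range_self (f := a) i)
  by_cases h : ∀ i, x i ≠ 0
  · have ha' : a = fun i => D ℤ K ((Units.mk0 (x i) (h i) : Kˣ) : K) := by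
      funext i
      rw [Units.val_mk0, hx i]
    rw [SetLike.mem_coe, ha', formsSpan_ιMulti_D_eq_prod_smul_dlogForm]
    exact Submodule.smul_mem _ _ (Submodule.subset_span (Set.mem_range_self _))
  · push Not at h
    obtain ⟨i, hi⟩ := h
    have key : exteriorPower.ιMulti K n a = 0 := by
      apply AlternatingMap.map_coord_zero (i := i)
      rw [← hx i, hi, map_zero]
    rw [SetLike.mem_coe, key]
    exact zero_mem _

end Literature.NumberTheory.GaloisCohomology.BlochKato1986Presentation

/-!
# Stub `bk_forward` of crux stmt-ResolutionOfSingularities-17142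
# (`WildPurity.PurityTransfer`, line `birth`, lead c1 skeleton rev L4)

The FORWARD comparison map of the Bloch–Kato presentation (Bloch–Kato 1986, Lemma (4.2)): for a
field `K` of characteristic `p` and `n ≥ 0` there is an additive map
`δ : KatoCohomologySymbolic p K n →+ KatoCohomologyDeRham p K n` with
`δ [a, b₀, …, b_{n-1}} = class of a · dlog b₀ ∧ ⋯ ∧ dlog b_{n-1}` (`formClass p a b`).

It is `KatoCohomologySymbolic.lift` applied to `formClass p`, which respects Kato's relations:
(1), (2), (3), (5) are the tree lemmas `formClass_add`, `formClass_update_mul`,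
`formClass_eq_zero_of_apply_eq`, `formClass_artinSchreier`; relation (4), `δ [bᵢ, b} = 0`, is the
EXACTNESS of the form `bᵢ · dlog b₀ ∧ ⋯ ∧ dlog b_{n-1}` (`bkForward_smul_dlogForm_mem_exactForms`):
after swapping slot `i` to the front (`AlternatingMap.map_swap`),
`b₀ · dlog b₀ ∧ dlog y₁ ∧ ⋯ = d (b₀ · dlog y₁ ∧ ⋯)` (`bkForward_d_smul_dlogForm`), because
`d (dlog y₁ ∧ ⋯ ∧ dlog yₘ) = 0` (`bkForward_d_dlogForm`, from `d (dlog u) = d(u⁻¹) ∧ du =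
-u⁻² • (du ∧ du) = 0` and the graded Leibniz rule in the exterior algebra of `Ω[K⁄ℤ]`).
-/




open Literature.NumberTheory.GaloisCohomology
open KaehlerDifferential (D)
open ExteriorAlgebra (ι)
open Literature.AlgebraicGeometry.Crystalline (ιMul coe_ιMul)
open Literature.AlgebraicGeometry.Crystalline.KaehlerExteriorDerivative

namespace Literature.NumberTheory.GaloisCohomology.BlochKato1986Presentation

/-- `d (dlog u) = 0` in the algebra of differential forms `⋀_K Ω[K⁄ℤ]`, for a unit `u`:
`d (u⁻¹ • du) = d(u⁻¹) ∧ du = -u⁻² • (du ∧ du) = 0`. [folklore]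
[cite: BlochKato1986, Lemma (4.2), p. 122] -/
theorem bkForward_extD_ι_unitDlog (K : Type u) [CommRing K] (u : Kˣ) :
    extD ℤ K (ι K (unitDlog K u)) = 0 := by
  unfold unitDlog
  rw [extD_ι_smul_D, (D ℤ K).leibniz_of_mul_eq_one (Units.inv_mul u), map_smul,
    smul_mul_assoc, ExteriorAlgebra.ι_sq_zero, smul_zero]

/-- `d (dlog v₀ ∧ ⋯ ∧ dlog v_{m-1}) = 0` in the algebra of differential forms `⋀_K Ω[K⁄ℤ]`
(graded Leibniz rule and `d (dlog u) = 0`). [folklore]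
[cite: BlochKato1986, Lemma (4.2), p. 122] -/
theorem bkForward_extD_ιMulti_unitDlog (K : Type u) [CommRing K] (m : ℕ) (v : Fin m → Kˣ) :
    extD ℤ K (ExteriorAlgebra.ιMulti K m fun i => unitDlog K (v i)) = 0 := by
  induction m with
  | zero =>
    rw [ExteriorAlgebra.ιMulti_zero_apply, ← (algebraMap K (ExteriorAlgebra K (Ω[K⁄ℤ]))).map_one,
      extD_algebraMap, Derivation.map_one_eq_zero, map_zero]
  | succ m ih =>
    rw [ExteriorAlgebra.ιMulti_succ_apply, extD_mul, CliffordAlgebra.involute_ι, neg_mul,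
      bkForward_extD_ι_unitDlog, zero_mul, zero_add]
    change -(ι K (unitDlog K (v 0)) *
      extD ℤ K (ExteriorAlgebra.ιMulti K m fun i => unitDlog K (Matrix.vecTail v i))) = 0
    rw [ih, mul_zero, neg_zero]

/-- `d (dlog y₀ ∧ ⋯ ∧ dlog y_{m-1}) = 0` for the exterior derivative on `m`-forms
`d : Ωᵐ_K → Ωᵐ⁺¹_K`. [folklore]
[cite: BlochKato1986, Lemma (4.2), p. 122] -/
theorem bkForward_d_dlogForm (K : Type u) [CommRing K] (m : ℕ) (y : Fin m → Kˣ) :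
    kaehlerExteriorDerivative ℤ K m (dlogForm K y) = 0 :=
  Subtype.ext (by
    rw [coe_kaehlerExteriorDerivative, dlogForm, exteriorPower.ιMulti_apply_coe,
      bkForward_extD_ιMulti_unitDlog, Submodule.coe_zero])

/-- **`d (b₀ · dlog y₀ ∧ ⋯ ∧ dlog y_{m-1}) = b₀ · dlog b₀ ∧ dlog y₀ ∧ ⋯ ∧ dlog y_{m-1}`**
(`= db₀ ∧ dlog y₀ ∧ ⋯`): the computation behind relation (4) of the Bloch–Kato presentation.
[cite: BlochKato1986, Lemma (4.2)] -/
theorem bkForward_d_smul_dlogForm (K : Type u) [CommRing K] (m : ℕ) (b₀ : Kˣ) (y : Fin m → Kˣ) :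
    kaehlerExteriorDerivative ℤ K m ((b₀ : K) • dlogForm K y) =
      (b₀ : K) • dlogForm K (Fin.cons b₀ y : Fin (m + 1) → Kˣ) := by
  rw [kaehlerExteriorDerivative_smul, bkForward_d_dlogForm, smul_zero, add_zero]
  apply Subtype.ext
  rw [coe_ιMul, Submodule.coe_smul, dlogForm, dlogForm, exteriorPower.ιMulti_apply_coe,
    exteriorPower.ιMulti_apply_coe, ExteriorAlgebra.ιMulti_succ_apply]
  change ι K (D ℤ K (b₀ : K)) * ExteriorAlgebra.ιMulti K m (fun i => unitDlog K (y i)) =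
    (b₀ : K) • (ι K (unitDlog K ((Fin.cons b₀ y : Fin (m + 1) → Kˣ) 0)) *
      ExteriorAlgebra.ιMulti K m fun i => unitDlog K ((Fin.cons b₀ y : Fin (m + 1) → Kˣ) i.succ))
  simp only [Fin.cons_zero, Fin.cons_succ]
  rw [unitDlog, map_smul, smul_mul_assoc, smul_smul, Units.mul_inv, one_smul]

/-- Relation (4) on forms, slot `0`: `b₀ · dlog b₀ ∧ ⋯ ∧ dlog bₘ ∈ Bᵐ⁺¹_K = dΩᵐ_K`.
[cite: BlochKato1986, Lemma (4.2)] -/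
theorem bkForward_smul_dlogForm_mem_exactForms_zero (K : Type u) [CommRing K] (m : ℕ)
    (b : Fin (m + 1) → Kˣ) : ((b 0 : Kˣ) : K) • dlogForm K b ∈ exactForms K (m + 1) := by
  rw [mem_exactForms_succ_iff]
  refine ⟨((b 0 : Kˣ) : K) • dlogForm K (Fin.tail b), ?_⟩
  rw [bkForward_d_smul_dlogForm, Fin.cons_self_tail]

/-- **Relation (4) on forms**: `bᵢ · dlog b₀ ∧ ⋯ ∧ dlog b_{n-1} ∈ Bⁿ_K = dΩⁿ⁻¹_K` is exact
(reduce to `i = 0` by the alternating property). [cite: BlochKato1986, Lemma (4.2)] -/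
theorem bkForward_smul_dlogForm_mem_exactForms (K : Type u) [CommRing K] {n : ℕ}
    (b : Fin n → Kˣ) (i : Fin n) : ((b i : Kˣ) : K) • dlogForm K b ∈ exactForms K n := by
  cases n with
  | zero => exact i.elim0
  | succ m =>
    by_cases hi : i = 0
    · subst hi
      exact bkForward_smul_dlogForm_mem_exactForms_zero K m b
    · have hswap : dlogForm K (b ∘ Equiv.swap 0 i) = -dlogForm K b :=
        (exteriorPower.ιMulti K (m + 1)).map_swap (fun j => unitDlog K (b j)) (Ne.symm hi)
      have h0 : (b ∘ Equiv.swap 0 i) 0 = b i := by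
        simp only [Function.comp_apply, Equiv.swap_apply_left]
      have h := bkForward_smul_dlogForm_mem_exactForms_zero K m (b ∘ Equiv.swap 0 i)
      rw [h0, hswap, smul_neg] at h
      exact neg_mem_iff.mp h

/-- **Stub `bk_forward`** — the forward comparison map of the Bloch–Kato presentation: for a
field `K` of characteristic `p` there is an additive map
`δ : KatoCohomologySymbolic p K n →+ KatoCohomologyDeRham p K n = Ωⁿ_K ⧸ (Bⁿ_K ⊔ AS)` with
`δ [a, b} = class of a · dlog b₀ ∧ ⋯ ∧ dlog b_{n-1}`. It is `KatoCohomologySymbolic.lift` of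
`formClass p`; relations (1), (2), (3), (5) hold on forms by `formClass_add`, `formClass_update_mul`,
`formClass_eq_zero_of_apply_eq`, `formClass_artinSchreier`, and relation (4) `[bᵢ, b} ↦ 0` because
`bᵢ · dlog b₀ ∧ ⋯ ∧ dlog b_{n-1}` is exact (`bkForward_smul_dlogForm_mem_exactForms`).
[cite: BlochKato1986, Lemma (4.2)] -/
theorem bk_forward (p : ℕ) [Fact p.Prime] (K : Type u) [Field K] [CharP K p] (n : ℕ) :
    ∃ φ : KatoCohomologySymbolic p K n →+ KatoCohomologyDeRham p K n,
      ∀ (a : K) (b : Fin n → Kˣ), φ (KatoCohomologySymbolic.symbol p a b) = formClass p a b :=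
  ⟨KatoCohomologySymbolic.lift p (formClass p)
    { add_left := formClass_add p
      update_mul := formClass_update_mul p
      eq_zero_of_apply_eq := fun a b _ _ hij h => formClass_eq_zero_of_apply_eq p a b hij h
      apply_self := fun b i => (QuotientAddGroup.eq_zero_iff _).2
        (AddSubgroup.mem_sup_left (bkForward_smul_dlogForm_mem_exactForms K b i))
      artinSchreier := formClass_artinSchreier p },
    fun a b => KatoCohomologySymbolic.lift_symbol p _ _ a b⟩

end Literature.NumberTheory.GaloisCohomology.BlochKato1986Presentation

/-!
# Stub `bk_descends` of crux stmt-ResolutionOfSingularities-17142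
# (`WildPurity.PurityTransfer`, line `birth`, lead c1 skeleton rev L4)

The DESCENT step of the Bloch–Kato presentation (Bloch–Kato 1986, Lemma (4.2), for a field `K` of
characteristic `p`): any ADDITIVE map `ψ₀ : Ωⁿ_K = ⋀ⁿ_K Ω[K⁄ℤ] → KatoCohomologySymbolic p K n` with
`ψ₀ (a • dlogForm K b) = [a, b}` vanishes on `exactForms K n ⊔ artinSchreierForms K p n`, i.e. it
factors through Kato's group of forms `KatoCohomologyDeRham p K n = Ωⁿ_K ⧸ (dΩⁿ⁻¹_K ⊔ AS)`:

* on the Artin–Schreier forms `(a ^ p - a) • dlogForm K b` by relation (5)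
  (`KatoCohomologySymbolic.symbol_artinSchreier`);
* on the exact forms `dη`, `η ∈ Ωⁿ⁻¹_K`: `Ωⁿ⁻¹_K` is `K`-spanned by the `dlogForm K y` (hypothesis
  `hspan`), so (`Submodule.span_induction`, the predicate `∀ c, ψ₀ (d (c • η)) = 0` being stable
  under sums and `K`-scalings) it suffices to treat `η = c • dlogForm K y`; for `c = 0` this is
  `d 0 = 0`, and for a unit `c = u` the landed computation
  `d (u • dlogForm K y) = du ∧ dlogForm K y = u • dlogForm K (Fin.cons u y)`
  (`bkForward_d_smul_dlogForm`, from `d (dlog) = 0`, file `WildPurityPurityTransferStubBkForward`)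
  has `ψ₀`-image `[u, u, y₀, …} = 0`, relation (4) (`KatoCohomologySymbolic.symbol_apply_self`).
-/




open Literature.NumberTheory.GaloisCohomology
open Literature.AlgebraicGeometry.Crystalline.KaehlerExteriorDerivative (kaehlerExteriorDerivative)

namespace Literature.NumberTheory.GaloisCohomology.BlochKato1986Presentation

/-- **Stub `bk_descends`** (Bloch–Kato 1986, Lemma (4.2), descent to Kato's group of forms):
for a field `K` of characteristic `p` whose `Ωᵐ_K` are spanned by the logarithmic forms (`hspan`),
any additive `ψ₀ : Ωⁿ_K → KatoCohomologySymbolic p K n` with `ψ₀ (a • dlogForm K b) = [a, b}` kills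
the exact forms `dΩⁿ⁻¹_K` (relation (4), via `d (u • dlogForm K y) = u • dlogForm K (Fin.cons u y)`)
and the Artin–Schreier forms `(a ^ p - a) • dlogForm K b` (relation (5)).
[cite: BlochKato1986, Lemma (4.2)] -/
theorem bk_descends (p : ℕ) [Fact p.Prime] (K : Type u) [Field K] [CharP K p] (n : ℕ)
    (hspan : ∀ m : ℕ, Submodule.span K (Set.range (dlogForm K (n := m))) = ⊤)
    (ψ₀ : (⋀[K]^n (Ω[K⁄ℤ])) →+ KatoCohomologySymbolic p K n)
    (hψ₀ : ∀ (a : K) (b : Fin n → Kˣ), ψ₀ (a • dlogForm K b) = KatoCohomologySymbolic.symbol p a b)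
    (ω : ⋀[K]^n (Ω[K⁄ℤ])) (hω : ω ∈ exactForms K n ⊔ artinSchreierForms K p n) : ψ₀ ω = 0 := by
  -- (ii) the Artin–Schreier forms die by relation (5)
  have hAS : artinSchreierForms K p n ≤ ψ₀.ker := by
    unfold artinSchreierForms
    rw [AddSubgroup.closure_le]
    rintro _ ⟨a, b, rfl⟩
    rw [SetLike.mem_coe, AddMonoidHom.mem_ker, hψ₀, KatoCohomologySymbolic.symbol_artinSchreier]
  -- (i) the exact forms die by relation (4)
  have hex : exactForms K n ≤ ψ₀.ker := by
    cases n with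
    | zero =>
      rw [exactForms_zero]
      exact bot_le
    | succ m =>
      intro x hx
      obtain ⟨η, rfl⟩ := (mem_exactForms_succ_iff K m x).1 hx
      clear hx
      rw [AddMonoidHom.mem_ker]
      have hη : η ∈ Submodule.span K (Set.range (dlogForm K (n := m))) := by
        rw [hspan m]
        exact Submodule.mem_top
      suffices h : ∀ c : K, ψ₀ (kaehlerExteriorDerivative ℤ K m (c • η)) = 0 by
        simpa only [one_smul] using h 1
      induction hη using Submodule.span_induction with
      | mem x hx =>
        obtain ⟨y, rfl⟩ := hx
        intro c
        rcases eq_or_ne c 0 with rfl | hc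
        · rw [zero_smul, map_zero, map_zero]
        · obtain ⟨u, rfl⟩ := hc.isUnit
          rw [bkForward_d_smul_dlogForm, hψ₀]
          have h :=
            KatoCohomologySymbolic.symbol_apply_self p (Fin.cons u y : Fin (m + 1) → Kˣ) 0
          rwa [Fin.cons_zero] at h
      | zero =>
        intro c
        rw [smul_zero, map_zero, map_zero]
      | add x x' _ _ hx hx' =>
        intro c
        rw [smul_add, map_add, map_add, hx c, hx' c, add_zero]
      | smul a x _ hx =>
        intro c
        rw [smul_smul]
        exact hx (c * a)
  exact (AddMonoidHom.mem_ker (f := ψ₀)).1 (sup_le hex hAS hω)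

end Literature.NumberTheory.GaloisCohomology.BlochKato1986Presentation

/-!
# Stub `bk_assemble` of crux stmt-ResolutionOfSingularities-17142
# (`WildPurity.PurityTransfer`, line `birth`, lead c1 skeleton rev L4)

Assembly of the Bloch–Kato presentation `BlochKato1986_symbolicPresentation`
(`KatoCohomologySymbolic p K n ≃+ KatoCohomologyDeRham p K n`, `[a, b} ↦ class of
a · dlog b₀ ∧ ⋯ ∧ dlog b_{n-1}`) from its four ingredients, taken as hypotheses:

* `hspan` — the logarithmic forms `dlogForm K b` span `Ωⁿ_K = ⋀ⁿ_K Ω[K⁄ℤ]` over `K`;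
* `hfwd`  — a forward additive map `φ` with `φ [a, b} = formClass p a b`;
* `hbwd`  — an additive map `ψ₀` on FORMS with `ψ₀ (a • dlogForm K b) = [a, b}`;
* `hdesc` — such a `ψ₀` kills the exact and the Artin–Schreier forms.

Pure algebra: `ψ₀` descends to `ψ` on the quotient `KatoCohomologyDeRham p K n`
(`QuotientAddGroup.lift`); `ψ ∘ φ = id` on symbols (`KatoCohomologySymbolic.hom_ext`), and
`φ ∘ ψ = id` because additive maps out of `Ωⁿ_K` agreeing on all `c • dlogForm K b` agree
(`hspan`, `Submodule.span_induction`) and maps out of the quotient are determined by their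
composite with the projection (`QuotientAddGroup.addMonoidHom_ext`).
-/




open Literature.NumberTheory.GaloisCohomology

namespace Literature.NumberTheory.GaloisCohomology.BlochKato1986Presentation

/-- Two additive maps out of `Ωⁿ_K = ⋀ⁿ_K Ω[K⁄ℤ]` that agree on every `c • dlogForm K b` are equal,
provided the logarithmic forms `dlogForm K b` span `Ωⁿ_K` over `K`. [folklore]
[cite: BlochKato1986, Lemma (4.2), p. 122] -/
theorem bkAssemble_addMonoidHom_ext {K : Type u} [CommRing K] {n : ℕ} {A : Type*} [AddCommGroup A]
    (hspan : Submodule.span K (Set.range (dlogForm K (n := n))) = ⊤)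
    {F G : (⋀[K]^n (Ω[K⁄ℤ])) →+ A}
    (h : ∀ (c : K) (b : Fin n → Kˣ), F (c • dlogForm K b) = G (c • dlogForm K b)) : F = G := by
  ext ω
  have hω : ω ∈ Submodule.span K (Set.range (dlogForm K (n := n))) := by
    rw [hspan]; exact Submodule.mem_top
  suffices key : ∀ c : K, F (c • ω) = G (c • ω) by simpa using key 1
  induction hω using Submodule.span_induction with
  | mem x hx =>
    obtain ⟨b, rfl⟩ := hx
    exact fun c => h c b
  | zero => intro c; simp
  | add x y _ _ hx hy => intro c; simp [smul_add, hx c, hy c]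
  | smul a x _ hx => intro c; rw [smul_smul]; exact hx (c * a)

/-- **Assembly of the Bloch–Kato presentation** from its four ingredients: the forward map `φ`
(`hfwd`) and the descent `ψ` of `ψ₀` (`hbwd`, `hdesc`) to
`KatoCohomologyDeRham p K n = Ωⁿ_K ⧸ (dΩⁿ⁻¹_K ⊔ AS)` (`QuotientAddGroup.lift`) are mutually inverse —
on symbols by `KatoCohomologySymbolic.hom_ext`, on form classes because the `a • dlogForm K b` span
`Ωⁿ_K` (`hspan`). [cite: BlochKato1986, Lemma (4.2)] -/
theorem bk_assemble
    (hspan : ∀ (K : Type u) [Field K] (m : ℕ), Submodule.span K (Set.range (dlogForm K (n := m))) = ⊤)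
    (hfwd : ∀ (p : ℕ) [Fact p.Prime] (K : Type u) [Field K] [CharP K p] (n : ℕ),
      ∃ φ : KatoCohomologySymbolic p K n →+ KatoCohomologyDeRham p K n,
        ∀ (a : K) (b : Fin n → Kˣ), φ (KatoCohomologySymbolic.symbol p a b) = formClass p a b)
    (hbwd : ∀ (p : ℕ) [Fact p.Prime] (K : Type u) [Field K] [CharP K p] (n : ℕ),
      ∃ ψ₀ : (⋀[K]^n (Ω[K⁄ℤ])) →+ KatoCohomologySymbolic p K n,
        ∀ (a : K) (b : Fin n → Kˣ), ψ₀ (a • dlogForm K b) = KatoCohomologySymbolic.symbol p a b)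
    (hdesc : ∀ (p : ℕ) [Fact p.Prime] (K : Type u) [Field K] [CharP K p] (n : ℕ),
      (∀ m : ℕ, Submodule.span K (Set.range (dlogForm K (n := m))) = ⊤) →
      ∀ (ψ₀ : (⋀[K]^n (Ω[K⁄ℤ])) →+ KatoCohomologySymbolic p K n),
        (∀ (a : K) (b : Fin n → Kˣ), ψ₀ (a • dlogForm K b) = KatoCohomologySymbolic.symbol p a b) →
        ∀ (ω : ⋀[K]^n (Ω[K⁄ℤ])), ω ∈ exactForms K n ⊔ artinSchreierForms K p n → ψ₀ ω = 0) :
    BlochKato1986_symbolicPresentation.{u} := by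
  intro p _ K _ _ n
  obtain ⟨φ, hφ⟩ := hfwd p K n
  obtain ⟨ψ₀, hψ₀⟩ := hbwd p K n
  have hker : exactForms K n ⊔ artinSchreierForms K p n ≤ ψ₀.ker :=
    fun ω hω => (AddMonoidHom.mem_ker).2 (hdesc p K n (hspan K) ψ₀ hψ₀ ω hω)
  let ψ : KatoCohomologyDeRham p K n →+ KatoCohomologySymbolic p K n :=
    QuotientAddGroup.lift (exactForms K n ⊔ artinSchreierForms K p n) ψ₀ hker
  have hψ : ∀ (a : K) (b : Fin n → Kˣ), ψ (formClass p a b) = KatoCohomologySymbolic.symbol p a b :=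
    fun a b => by
      show QuotientAddGroup.lift _ ψ₀ hker (QuotientAddGroup.mk (a • dlogForm K b)) = _
      rw [QuotientAddGroup.lift_mk, hψ₀]
  have h₁ : ψ.comp φ = AddMonoidHom.id _ :=
    KatoCohomologySymbolic.hom_ext p fun a b => by
      simp only [AddMonoidHom.comp_apply, AddMonoidHom.id_apply, hφ, hψ]
  have h₂ : φ.comp ψ = AddMonoidHom.id _ := by
    refine QuotientAddGroup.addMonoidHom_ext _ (bkAssemble_addMonoidHom_ext (hspan K n) ?_)
    intro c b
    simp only [AddMonoidHom.comp_apply, AddMonoidHom.id_apply, QuotientAddGroup.mk'_apply]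
    have : (QuotientAddGroup.mk (c • dlogForm K b) : KatoCohomologyDeRham p K n) = formClass p c b :=
      rfl
    rw [this, hψ, hφ]
  exact ⟨φ.toAddEquiv ψ h₁ h₂, hφ⟩

end Literature.NumberTheory.GaloisCohomology.BlochKato1986Presentation

/-!
# The named fact `BlochKato1986_symbolicPresentation` is a THEOREM
# (crux `WildPurity.PurityTransfer`, stmt-ResolutionOfSingularities-17142, line `birth`, lead c1)

Discharge of the tree's named fact
`Literature.NumberTheory.GaloisCohomology.BlochKato1986_symbolicPresentation`
(`KatoCohomologyDifferentialForms.lean`): for every `p` prime and every field `K` of characteristic `p`,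
Kato's symbolic group `KatoCohomologySymbolic p K n` (generators `[a, b₁, …, bₙ}`) is isomorphic to
`KatoCohomologyDeRham p K n = Ωⁿ_K ⧸ (dΩⁿ⁻¹_K + ⟨(a^p − a) dlog b⟩)` by `[a, b} ↦ a · dlog b₁ ∧ ⋯ ∧ dlog bₙ`
— Bloch–Kato 1986, Lemma (4.2) ("Straightforward and left to the reader"), assembled from the landed
stubs of the lead's skeleton rev L4:

* `bk_formsSpan` (p163554) — the `dlogForm K b` span `Ωⁿ_K` (surjectivity of `δ`);
* `bk_forward` (p163789) — `δ` exists on the symbolic group (relation (4) = exactness of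
  `bᵢ • dlogForm K b`);
* `bk_descends` (p164190) — an inverse on forms kills `dΩⁿ⁻¹ ⊔ AS`;
* `bk_assemble` (p164347) — the two maps are mutually inverse;
* the inverse on forms itself: `BlochKatoForms.exists_addMonoidHom_forms_symbol`
  (`Literature/NumberTheory/GaloisCohomology/BlochKatoForms.lean` p164219 — the presentation module and
  the alternating comparison map `Ωⁿ_K → BlochKatoForms K n` — and `…/BlochKatoFormsSymbol.lean`).

With this, the crux's remaining dependency is Gros–Suwa purity ON DIFFERENTIAL FORMS only
(`bk_purityTransport`, p163682, transports it to the symbolic `GrosSuwa1988_purity`).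
-/




open Literature.NumberTheory.GaloisCohomology

namespace Literature.NumberTheory.GaloisCohomology.BlochKato1986Presentation

end Literature.NumberTheory.GaloisCohomology.BlochKato1986Presentation

namespace Literature.NumberTheory.GaloisCohomology

open BlochKato1986Presentation

/-- **Bloch–Kato 1986, Lemma (4.2), for fields: the symbolic presentation of Kato's `H^{n+1}_p(K)`** —
the named fact `BlochKato1986_symbolicPresentation` holds: for `p` prime and `K` a field of characteristic
`p`, there is an additive isomorphism `KatoCohomologySymbolic p K n ≃+ KatoCohomologyDeRham p K n` sending
`[a, b}` to the class of `a · dlog b₀ ∧ ⋯ ∧ dlog b_{n-1}`.  Proof: `bk_assemble` applied to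
`bk_formsSpan`, `bk_forward`, `BlochKatoForms.exists_addMonoidHom_forms_symbol`, `bk_descends`.
[cite: BlochKato1986, Lemma (4.2), p. 122] -/
theorem BlochKato1986_symbolicPresentation_holds : BlochKato1986_symbolicPresentation.{u} :=
  bk_assemble.{u} bk_formsSpan.{u} bk_forward.{u}
    (fun p _ K _ _ _ => BlochKatoForms.exists_addMonoidHom_forms_symbol K p) bk_descends.{u}

end Literature.NumberTheory.GaloisCohomology

end
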